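import Mathlib
import Literature.MathematicalPhysics.QuantumLattice.HubbardBandSectorCountingToolbox
import Literature.MathematicalPhysics.QuantumLattice.HubbardUmklappKinematics
import Summits.HubbardSuperconductivity.HubbardSuperconductivity.Theorems.KLProgrammeKLRegimeTwoPointLimitShellAngularCausticMain
import HarnessLib

/-!
# Route `KLProgramme` — crux K3 `KLRegimeTwoPointLimit` (stmt-HubbardSuperconductivity-19937), support:
# Lemmas E.1 / E.3 PACKAGED away from the Cooper point — the `O(δ) + O(√δ)` angular bound with
# constants depending only on the band window (DECOMP App. E; companion of `…ShellAngularBound`)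

Cell `gate-hubbard-kl`, seat p1b; paper note `HOME/prover-p1b/E1-NOTE.md` §2 (second display) and §4
(constants). `klsh_volume_sublevel_le_caustic` bounds the angular sublevel set
`Θ_w(δ) = {θ ∈ [θ₀, θ₀ + 2π] : |ε(p_μ(θ) - w) - μ| ≤ δ}` of the translated band Fermi curve, for a
transfer `w` at torus sup-distance `≥ v` from the Cooper point `2πℤ²` (incl. ON the `2k_F` caustic
`2F_μ + 2πℤ²`), under eleven explicit inequalities between its window / count / slope parameters
`(η, λ, ℓ, η₁, ρ₂)` and the fields of `BandBounds`. This file DISCHARGES them: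

* `klan_exists_away_bound` — for a margin `η⋆ > 0` and every `v > 0` there are `δ₁, C₁, C₂ > 0`
  (depending only on `B`, `η⋆`, `v`) with `|Θ_w(δ)| ≤ C₁·δ + C₂·√δ` for all such `w` and all
  `0 < δ ≤ δ₁` — the `ε₂^{1/2}` law of Lemma E.3, uniformly up to and on the caustic.

The explicit choices: `ρ₂ = min(√2 u_min, κ₃/2, 2h_min/M₃)`, `κ₃ = min(√2 u_min, 2π - 2K(b))`,
`M₃ = (4s² + 4A₂)(2sπ/(√2 u_min) + 1)` (so the convexity constant at the caustic windows is
`≥ 2h_min`); `η₁ = min(η⋆, 1, ρ₂/κ₄, v/(2κ₂))`, `κ₂ = (2s²C_g + 1)/Dt`, `κ₄ = κ₂ + A₂s²C_g²/Dt² + 1/2`,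
`ℓ = η₁/(4s)`; `λ = τ`, `η = Dt τ/(2s)` with `τ = min(1, 2sη⋆/Dt, v/(2M₁), ρ₂/(2M₂))`,
`M₁ = 2sC_g + 1/(2s)`, `M₂ = M₁ + A₂C_g²`; `δ₁ = min(η, 4πτ, ρ₂τ/(4s))`; then `C₁ = 3(2π/ℓ + 25)/τ`,
`C₂ = 72/√(2h_min)`. Not here: the `δ/√dist(w, 2F)` refinement near (not on) the caustic (E1-NOTE
§2; the `√δ` cap already makes the `2k_F` contributions summable over scales).
-/

noncomputable section

-- the tree's namespace `Summit.<Summit>.<Problem>.Theorems` repeats the summit name by design (D-0017)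
set_option linter.dupNamespace false

open Real Set MeasureTheory
open scoped ENNReal
open Literature.MathematicalPhysics.QuantumLattice
open Literature.MathematicalPhysics.QuantumLattice.BandSectorCounting

namespace Summit.HubbardSuperconductivity.HubbardSuperconductivity.Theorems

section Main

variable {a b : ℝ} (B : BandBounds a b)
include B

/-! ### Away from the Cooper point (incl. the caustic), packaged -/

/-- **Lemmas E.1/E.3 away from the Cooper point, packaged.** For a margin `η⋆ > 0` and a threshold
`v > 0` there are `δ₁, C₁, C₂ > 0`, depending only on `B`, `η⋆`, `v`, such that for every level `μ`
with `μ ± η⋆` in the range, every `0 < δ ≤ δ₁`, every transfer `w` at torus sup-distance `≥ v` from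
`2πℤ²`, and every period: `|{θ ∈ [θ₀, θ₀ + 2π] : |ε(p_μ(θ) - w) - μ| ≤ δ}| ≤ C₁·δ + C₂·√δ`. This is
`klsh_volume_sublevel_le_caustic` with all its window / count / slope parameters chosen as explicit
functions of the fields of `B` (module docstring); the `√δ` term is the `2k_F` law of Lemma E.3 and is
present whether or not `w` is near the caustic `2F_μ + 2πℤ²`. -/
theorem klan_exists_away_bound {ηs v : ℝ} (hηs : 0 < ηs) (hv0 : 0 < v) :
    ∃ δ₁ C₁ C₂ : ℝ, 0 < δ₁ ∧ 0 < C₁ ∧ 0 < C₂ ∧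
      ∀ (μ : ℝ), a ≤ μ - ηs → μ + ηs ≤ b → ∀ (δ w₁ w₂ θ₀ : ℝ), 0 < δ → δ ≤ δ₁ →
        (∀ m₀ m₁ : ℤ, v ≤ max |w₁ - m₀ * (2 * π)| |w₂ - m₁ * (2 * π)|) →
        volume {θ ∈ Icc θ₀ (θ₀ + 2 * π) | |eps2 (bandX μ θ - w₁) (bandY μ θ - w₂) - μ| ≤ δ} ≤
          ENNReal.ofReal (C₁ * δ + C₂ * Real.sqrt δ) := by
  have hπ := Real.pi_pos
  have hs := B.smax_pos
  have hC := B.Cg_pos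
  have hD := B.Dtmin_pos
  have hρ := B.rhomin_pos
  have hA := B.A2_pos
  have hu := B.umin_pos
  have hh := B.hmin_pos
  have hs' := hs.ne'
  have hC' := hC.ne'
  have hD' := hD.ne'
  have hA' := hA.ne'
  have hu' := hu.ne'
  have hh' := hh.ne'
  have hKb : umklappRadius b < π := umklappRadius_lt_pi B.hb
  have h2u : 0 < Real.sqrt 2 * B.umin := by positivity
  have h2u' := h2u.ne'
  have hsq2 : Real.sqrt 2 ≠ 0 := by positivity
  -- constants (opaque names with defining equations)
  obtain ⟨κ₂, hκ₂⟩ : ∃ x : ℝ, x = (2 * B.smax ^ 2 * B.Cg + 1) / B.Dtmin := ⟨_, rfl⟩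
  obtain ⟨κ₃, hκ₃⟩ : ∃ x : ℝ, x = min (Real.sqrt 2 * B.umin) (2 * π - 2 * umklappRadius b) :=
    ⟨_, rfl⟩
  obtain ⟨M₃, hM₃⟩ : ∃ x : ℝ, x =
    (4 * B.smax ^ 2 + 4 * B.A2) * (2 * B.smax * π / (Real.sqrt 2 * B.umin) + 1) := ⟨_, rfl⟩
  have hκ₂0 : 0 < κ₂ := by rw [hκ₂]; positivity
  have hκ₃0 : 0 < κ₃ := by rw [hκ₃]; exact lt_min h2u (by linarith)
  have hM₃0 : 0 < M₃ := by rw [hM₃]; positivity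
  have hκ₂' := hκ₂0.ne'
  have hM₃' := hM₃0.ne'
  obtain ⟨ρ₂, hρ₂⟩ : ∃ x : ℝ, x = min (min (Real.sqrt 2 * B.umin) (κ₃ / 2)) (2 * B.hmin / M₃) :=
    ⟨_, rfl⟩
  have hρ₂0 : 0 < ρ₂ := by rw [hρ₂]; exact lt_min (lt_min h2u (by positivity)) (by positivity)
  have hρ₂1 : ρ₂ ≤ Real.sqrt 2 * B.umin := by rw [hρ₂]; exact (min_le_left _ _).trans (min_le_left _ _)
  have hρ₂2 : ρ₂ ≤ κ₃ / 2 := by rw [hρ₂]; exact (min_le_left _ _).trans (min_le_right _ _)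
  have hρ₂3 : ρ₂ ≤ 2 * B.hmin / M₃ := by rw [hρ₂]; exact min_le_right _ _
  obtain ⟨κ₄, hκ₄⟩ : ∃ x : ℝ, x = κ₂ + B.A2 * B.smax ^ 2 * B.Cg ^ 2 / B.Dtmin ^ 2 + 1 / 2 :=
    ⟨_, rfl⟩
  have hκ₄0 : 0 < κ₄ := by rw [hκ₄]; positivity
  have hκ₄' := hκ₄0.ne'
  obtain ⟨η₁, hη₁⟩ : ∃ x : ℝ, x = min (min (min ηs 1) (ρ₂ / κ₄)) (v / (2 * κ₂)) := ⟨_, rfl⟩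
  have hη₁0 : 0 < η₁ := by
    rw [hη₁]; exact lt_min (lt_min (lt_min hηs one_pos) (by positivity)) (by positivity)
  have hη₁1 : η₁ ≤ ηs := by
    rw [hη₁]; exact ((min_le_left _ _).trans (min_le_left _ _)).trans (min_le_left _ _)
  have hη₁2 : η₁ ≤ 1 := by
    rw [hη₁]; exact ((min_le_left _ _).trans (min_le_left _ _)).trans (min_le_right _ _)
  have hη₁3 : η₁ ≤ ρ₂ / κ₄ := by rw [hη₁]; exact (min_le_left _ _).trans (min_le_right _ _)
  have hη₁4 : η₁ ≤ v / (2 * κ₂) := by rw [hη₁]; exact min_le_right _ _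
  obtain ⟨ℓ, hℓ⟩ : ∃ x : ℝ, x = η₁ / (4 * B.smax) := ⟨_, rfl⟩
  have hℓ0 : 0 < ℓ := by rw [hℓ]; positivity
  have hℓ' := hℓ0.ne'
  obtain ⟨M₁, hM₁⟩ : ∃ x : ℝ, x = 2 * B.smax * B.Cg + 1 / (2 * B.smax) := ⟨_, rfl⟩
  obtain ⟨M₂, hM₂⟩ : ∃ x : ℝ, x = 2 * B.smax * B.Cg + B.A2 * B.Cg ^ 2 + 1 / (2 * B.smax) := ⟨_, rfl⟩
  have hM₁0 : 0 < M₁ := by rw [hM₁]; positivity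
  have hM₂0 : 0 < M₂ := by rw [hM₂]; positivity
  have hM₁' := hM₁0.ne'
  have hM₂' := hM₂0.ne'
  obtain ⟨τ, hτ⟩ : ∃ x : ℝ, x =
    min (min (min 1 (2 * B.smax * ηs / B.Dtmin)) (v / (2 * M₁))) (ρ₂ / (2 * M₂)) := ⟨_, rfl⟩
  have hτ0 : 0 < τ := by
    rw [hτ]; exact lt_min (lt_min (lt_min one_pos (by positivity)) (by positivity)) (by positivity)
  have hτ1 : τ ≤ 1 := by rw [hτ]; exact ((min_le_left _ _).trans (min_le_left _ _)).trans (min_le_left _ _)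
  have hτ2 : τ ≤ 2 * B.smax * ηs / B.Dtmin := by
    rw [hτ]; exact ((min_le_left _ _).trans (min_le_left _ _)).trans (min_le_right _ _)
  have hτ3 : τ ≤ v / (2 * M₁) := by rw [hτ]; exact (min_le_left _ _).trans (min_le_right _ _)
  have hτ4 : τ ≤ ρ₂ / (2 * M₂) := by rw [hτ]; exact min_le_right _ _
  have hτ' := hτ0.ne'
  obtain ⟨η, hη⟩ : ∃ x : ℝ, x = B.Dtmin * τ / (2 * B.smax) := ⟨_, rfl⟩
  have hη0 : 0 < η := by rw [hη]; positivity
  have hηs' : η ≤ ηs := by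
    rw [hη, div_le_iff₀ (by positivity)]
    have := hτ2; rw [le_div_iff₀ hD] at this; linarith
  obtain ⟨δ₁, hδ₁⟩ : ∃ x : ℝ, x = min (min η (4 * π * τ)) (ρ₂ * τ / (4 * B.smax)) := ⟨_, rfl⟩
  have hδ₁0 : 0 < δ₁ := by rw [hδ₁]; exact lt_min (lt_min hη0 (by positivity)) (by positivity)
  have hδ₁1 : δ₁ ≤ η := by rw [hδ₁]; exact (min_le_left _ _).trans (min_le_left _ _)
  have hδ₁2 : δ₁ ≤ 4 * π * τ := by rw [hδ₁]; exact (min_le_left _ _).trans (min_le_right _ _)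
  have hδ₁3 : δ₁ ≤ ρ₂ * τ / (4 * B.smax) := by rw [hδ₁]; exact min_le_right _ _
  obtain ⟨cc, hcc⟩ : ∃ x : ℝ, x = 4 * B.hmin - (4 * B.smax ^ 2 + 4 * B.A2) *
    (2 * B.smax * (π * (ρ₂ / (Real.sqrt 2 * B.umin))) + ρ₂) := ⟨_, rfl⟩
  have hccM : cc = 4 * B.hmin - M₃ * ρ₂ := by rw [hcc, hM₃]; field_simp
  have hcc2 : 2 * B.hmin ≤ cc := by
    rw [hccM]
    have h1 : M₃ * ρ₂ ≤ M₃ * (2 * B.hmin / M₃) := mul_le_mul_of_nonneg_left hρ₂3 hM₃0.le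
    have e : M₃ * (2 * B.hmin / M₃) = 2 * B.hmin := by field_simp
    linarith
  have hcc0 : 0 < cc := by linarith
  obtain ⟨C₁, hC₁⟩ : ∃ x : ℝ, x = 3 * (2 * π / ℓ + 25) / τ := ⟨_, rfl⟩
  obtain ⟨C₂, hC₂⟩ : ∃ x : ℝ, x = 72 / Real.sqrt (2 * B.hmin) := ⟨_, rfl⟩
  have hC₁0 : 0 < C₁ := by rw [hC₁]; positivity
  have hC₂0 : 0 < C₂ := by rw [hC₂]; positivity
  refine ⟨δ₁, C₁, C₂, hδ₁0, hC₁0, hC₂0, ?_⟩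
  intro μ hlo hhi δ w₁ w₂ θ₀ hδ hδδ₁ hv
  have hμ : μ ∈ Icc a b := ⟨by linarith, by linarith⟩
  have hKμ : umklappRadius μ ≤ umklappRadius b := umklappRadius_mono hμ.2
  -- the hypotheses of `klsh_volume_sublevel_le_caustic`
  have hloη : a ≤ μ - η := by linarith
  have hhiη : μ + η ≤ b := by linarith
  have hδη : δ ≤ η := hδδ₁.trans hδ₁1
  have hδl : δ / (2 * τ) ≤ 2 * π := by
    rw [div_le_iff₀ (by positivity)]; linarith [hδδ₁.trans hδ₁2]
  have eX : 2 * B.smax * (η / B.Dtmin) = τ := by rw [hη]; field_simp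
  have eD : η / B.Dtmin = τ / (2 * B.smax) := by rw [hη]; field_simp
  have hH1 : B.smax * (B.Cg * (τ + 2 * B.smax * (η / B.Dtmin))) + η / B.Dtmin < v := by
    rw [eX, eD]
    have e : B.smax * (B.Cg * (τ + τ)) + τ / (2 * B.smax) = M₁ * τ := by rw [hM₁]; field_simp; ring
    rw [e]
    have h1 : M₁ * τ ≤ M₁ * (v / (2 * M₁)) := mul_le_mul_of_nonneg_left hτ3 hM₁0.le
    have h2 : M₁ * (v / (2 * M₁)) = v / 2 := by field_simp
    linarith
  have hρ₂h : B.smax * (B.Cg * (τ + 2 * B.smax * (η / B.Dtmin))) +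
      B.A2 / 4 * (B.Cg * (τ + 2 * B.smax * (η / B.Dtmin))) ^ 2 + η / B.Dtmin +
      2 * B.smax * (δ / (2 * τ)) ≤ ρ₂ := by
    rw [eX, eD]
    have e : B.smax * (B.Cg * (τ + τ)) + B.A2 / 4 * (B.Cg * (τ + τ)) ^ 2 + τ / (2 * B.smax) +
        2 * B.smax * (δ / (2 * τ)) =
        (2 * B.smax * B.Cg + 1 / (2 * B.smax)) * τ + B.A2 * B.Cg ^ 2 * τ ^ 2 + B.smax * δ / τ := by
      field_simp; ring
    rw [e]
    have hτsq : τ ^ 2 ≤ τ := by rw [sq]; exact mul_le_of_le_one_right hτ0.le hτ1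
    have h1 : B.A2 * B.Cg ^ 2 * τ ^ 2 ≤ B.A2 * B.Cg ^ 2 * τ :=
      mul_le_mul_of_nonneg_left hτsq (by positivity)
    have h2 : (2 * B.smax * B.Cg + 1 / (2 * B.smax)) * τ + B.A2 * B.Cg ^ 2 * τ = M₂ * τ := by
      rw [hM₂]; ring
    have h3 : M₂ * τ ≤ M₂ * (ρ₂ / (2 * M₂)) := mul_le_mul_of_nonneg_left hτ4 hM₂0.le
    have h4 : M₂ * (ρ₂ / (2 * M₂)) = ρ₂ / 2 := by field_simp
    have h5 : B.smax * δ / τ ≤ ρ₂ / 4 := by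
      rw [div_le_iff₀ hτ0]
      have := hδδ₁.trans hδ₁3
      rw [le_div_iff₀ (by positivity)] at this
      linarith
    linarith
  have hlo₁ : a ≤ μ - η₁ := by linarith
  have hhi₁ : μ + η₁ ≤ b := by linarith
  have hηℓ : 4 * B.smax * ℓ ≤ η₁ := by
    have e : 4 * B.smax * ℓ = η₁ := by rw [hℓ]; field_simp
    exact e.le
  have eκ : B.smax * (B.Cg * (2 * B.smax * (η₁ / B.Dtmin))) + η₁ / B.Dtmin = κ₂ * η₁ := by
    rw [hκ₂]; field_simp
  have hH1c : B.smax * (B.Cg * (2 * B.smax * (η₁ / B.Dtmin))) + η₁ / B.Dtmin < v := by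
    rw [eκ]
    have h1 : κ₂ * η₁ ≤ κ₂ * (v / (2 * κ₂)) := mul_le_mul_of_nonneg_left hη₁4 hκ₂0.le
    have h2 : κ₂ * (v / (2 * κ₂)) = v / 2 := by field_simp
    linarith
  have hρ₂c : B.smax * (B.Cg * (2 * B.smax * (η₁ / B.Dtmin))) +
      B.A2 / 4 * (B.Cg * (2 * B.smax * (η₁ / B.Dtmin))) ^ 2 + η₁ / B.Dtmin + 2 * B.smax * ℓ ≤ ρ₂ := by
    have e : B.smax * (B.Cg * (2 * B.smax * (η₁ / B.Dtmin))) +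
        B.A2 / 4 * (B.Cg * (2 * B.smax * (η₁ / B.Dtmin))) ^ 2 + η₁ / B.Dtmin + 2 * B.smax * ℓ =
        κ₂ * η₁ + B.A2 * B.smax ^ 2 * B.Cg ^ 2 / B.Dtmin ^ 2 * η₁ ^ 2 + η₁ / 2 := by
      rw [hκ₂, hℓ]; field_simp; ring
    rw [e]
    have hη₁sq : η₁ ^ 2 ≤ η₁ := by rw [sq]; exact mul_le_of_le_one_right hη₁0.le hη₁2
    have h1 : B.A2 * B.smax ^ 2 * B.Cg ^ 2 / B.Dtmin ^ 2 * η₁ ^ 2 ≤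
        B.A2 * B.smax ^ 2 * B.Cg ^ 2 / B.Dtmin ^ 2 * η₁ :=
      mul_le_mul_of_nonneg_left hη₁sq (by positivity)
    have h2 : κ₂ * η₁ + B.A2 * B.smax ^ 2 * B.Cg ^ 2 / B.Dtmin ^ 2 * η₁ + η₁ / 2 = κ₄ * η₁ := by
      rw [hκ₄]; ring
    have h3 : κ₄ * η₁ ≤ κ₄ * (ρ₂ / κ₄) := mul_le_mul_of_nonneg_left hη₁3 hκ₄0.le
    have h4 : κ₄ * (ρ₂ / κ₄) = ρ₂ := by field_simp
    linarith
  have hσ : ρ₂ / (Real.sqrt 2 * B.umin) < 2 := by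
    rw [div_lt_iff₀ h2u]; linarith
  have hc : 0 < 4 * B.hmin - (4 * B.smax ^ 2 + 4 * B.A2) *
      (2 * B.smax * (π * (ρ₂ / (Real.sqrt 2 * B.umin))) + ρ₂) := hcc ▸ hcc0
  have hH4 : 2 * umklappRadius μ + ρ₂ < 2 * π := by
    have : κ₃ ≤ 2 * π - 2 * umklappRadius b := hκ₃ ▸ min_le_right _ _
    linarith
  have hmain := klsh_volume_sublevel_le_caustic B hμ (θ₀ := θ₀) hloη hhiη hδη hδ hτ0 hδl hv hH1 hρ₂h
    hlo₁ hhi₁ hℓ0 hηℓ hH1c hρ₂c hσ hc hH4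
  refine hmain.trans ?_
  rw [← hcc]
  -- repackage the right-hand side
  have hx0 : 0 ≤ 3 * (2 * π / ℓ + 25) := by positivity
  have e1 : ENNReal.ofReal (3 * (2 * π / ℓ + 25)) * ENNReal.ofReal (δ / τ) +
      12 * ENNReal.ofReal (6 * Real.sqrt (δ / cc)) =
      ENNReal.ofReal (3 * (2 * π / ℓ + 25) * (δ / τ) + 12 * (6 * Real.sqrt (δ / cc))) := by
    rw [ENNReal.ofReal_add (by positivity) (by positivity), ENNReal.ofReal_mul hx0,
      ENNReal.ofReal_mul (by norm_num : (0 : ℝ) ≤ 12), ENNReal.ofReal_ofNat]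
  rw [e1]
  apply ENNReal.ofReal_le_ofReal
  have h1 : 3 * (2 * π / ℓ + 25) * (δ / τ) = C₁ * δ := by rw [hC₁]; field_simp
  have h2 : Real.sqrt (δ / cc) ≤ Real.sqrt δ / Real.sqrt (2 * B.hmin) := by
    rw [Real.sqrt_div' δ hcc0.le]
    exact div_le_div_of_nonneg_left (Real.sqrt_nonneg _) (Real.sqrt_pos.2 (by positivity))
      (Real.sqrt_le_sqrt hcc2)
  have h3 : 12 * (6 * (Real.sqrt δ / Real.sqrt (2 * B.hmin))) = C₂ * Real.sqrt δ := by
    rw [hC₂]; field_simp; ring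
  have h4 : 12 * (6 * Real.sqrt (δ / cc)) ≤ 12 * (6 * (Real.sqrt δ / Real.sqrt (2 * B.hmin))) :=
    mul_le_mul_of_nonneg_left (mul_le_mul_of_nonneg_left h2 (by norm_num)) (by norm_num)
  linarith

end Main

end Summit.HubbardSuperconductivity.HubbardSuperconductivity.Theorems

end
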